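/-
Copyright (c) 2026 the pub-hodgecm-mathlib formalisation cell (harness21).  Prover seat hodgecm-mathlib-K2Liu-p02 (g7), Track B «K2-LIT» ∕ hLiu418
#184♮, #42S payer road (σ), V8-inst-A organ, V5-inst (f) PART 2a (LEAD F0P6-plan (g14) BATCH #13 (4)(f) ∕ #16 (1) ∕ #17 (3): «(f) = p02 ON I-2»; K2Liu-p09 (g6)
I-2 13:17:50Z; K2Liu-p02 (g7) cut 13:18:48Z).  DEFINITION LANE (`bmat`, `gramLoc`, `qLoc`) + theorems.
-/
import Summits.HodgeConjecture.HodgeConjecture.Theorems.K2LiuA7ValueInstanceDefs         -- ★ I-2 p860501 (`rhoLoc`, `leviRhoLoc`, `leviDeltaLoc`; I-0 `reFrame`∕`leviAct`; I-1b)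
import Summits.HodgeConjecture.HodgeConjecture.Theorems.K2LiuNullConeOrbitsNonsplitLocal   -- ★ p860486 ((O1) in the `«local»` currency at a non-split place)
import HarnessLib

/-!
# Crux `HLiu418`, (σ) V5-inst (f) PART 2a: THE MOMENT MAP `q` OF THE Δ-MODEL (`x ↦` the Gram matrix of the pair of vectors of `V′_v`), ITS INVARIANCE
# UNDER THE PARTNER ACTION `ρ` (`hNρ`, exact) AND THE LEVI ACTION `aX` (`hNa`), AND THE NULL-CONE TRANSITIVITY `htrans` AT A NON-SPLIT PLACE

Cell `hodgecm-mathlib`, crux item hLiu418 = `stmt-HodgeConjecture-24832`; squad K2 ∕ K2Liu; prover K2Liu-p02 (g7).  DEFINITION LANE: three `def`s (`bmat`, `gramLoc`, `qLoc` —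
the `q` binder of ★ V8e `K2LiuA7ValueFaceTwo.face_two_of_laws` at the instance of record ★ I-2 `K2LiuA7ValueInstanceDefs`); everything else theorems; no instance, no notation, no
`sorry`; lane `--supports stmt-HodgeConjecture-24832 --as helper`.

THE DICTIONARY (★ I-0 `reFrame`, ★ I-2 `rhoLoc`∕`leviRhoLoc`).  A point `x ∈ X_Δ = L⁺_v^{n′+n′}` of ★ β-1's Δ-model of the big datum `𝔻 ⊗ V′` is `x = R b`, `b : Fin n′ → L ⊗ L⁺_v`;
through ★ `epsV : Fin n × Fin M₂ ≃ Fin n′` it is an `n × M₂` matrix **`bmat b`** over `L ⊗ L⁺_v` — `n` vectors of `V′_v = (L ⊗ L⁺_v)^{M₂}` (its rows).  The partner `g ∈ U(V′)(L⁺_v)` acts by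
`bmat ↦ bmat · Gᵀ` (★ I-2 `val_partnerBlkDHom`, `bmat_mulVec_one_kronecker`), the Siegel Levi `m ∈ M_Δ` by `bmat ↦ D(m) · bmat` (★ I-2 `val_leviBlkD`, `bmat_mulVec_kronecker_one`).
**`gramLoc b := (bmat b)^σ · J′_v · (bmat b)ᵀ`** (`J′_v` = the local Gram matrix of `V′ = (L^{M₂}, diag dV′)`, ★ `UnitaryGroup.local`) is the `n × n` GRAM MATRIX of the `n` vectors, and
**`qLoc x`** = the vector of the `re`∕`im` coordinates (★ `quadraticLocalEquiv`) of the entries of `gramLoc (R⁻¹ x)`, indexed by `ι := Fin n × Fin n ⊕ Fin n × Fin n` — THE MOMENT MAP,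
the `q` of V8e (`{q = 0}` = the null cone = pairs of vectors spanning an isotropic subspace).
* §1 `bmat`, `bmat_injective`, `bmat_mulVec_reindex`, `bmat_mulVec_one_kronecker`, `bmat_mulVec_kronecker_one`; `gramLoc`, **`gramLoc_mulVec_one_kronecker`** (`G ∈ U(J′)_v ⇒ gramLoc (bmat Gᵀ) = gramLoc`),
  **`gramLoc_mulVec_kronecker_one`** (`gramLoc (D bmat) = D^σ · gramLoc · Dᵀ`), `gramLoc_transpose_currency` (the `3 × 2`-columns form of ★ `K2LiuNullConeOrbitsNonsplitLocal`).
* §2 `qLoc`, **`continuous_qLoc`** (= `hq`), **`qLoc_eq_zero_iff`**, **`qLoc_rhoLoc`** (= `hNρ`, exact invariance), **`qLoc_leviRhoLoc_eq_zero`** (= `hNa`).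
* §3 (`n = 2`, `M₂ = 3`, non-split `v`: `(w) (hw : c • w = w) (hc : c ≠ 1)`) **`exists_leviRhoLoc_rhoLoc_eq`** (= `htrans`): for non-zero `x, y ∈ {q = 0}` there are `m ∈ M_Δ`, `g ∈ U(V′)(L⁺_v)` with
  `aX m (ρ g x) = y` — from ★ `exists_local_mul_mul_eq_of_null` and the surjectivity letter `hsurj : ∀ D ∈ GL_n(L ⊗ L⁺_v), ∃ m ∈ M_Δ, D(m) = D` (BY VALUE; K2Liu-p09 (g6) types it from ★
  `ofAdapted`, bus 13:17:50Z).  At a SPLIT place `htrans` is false (rank strata, ★ `K2LiuNullConeOrbitsSplit`) — the split road is the stratified face.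
PART 2b (`nΔ`, `hnΔ`, `hN`) follows the ω of record (I-3).
References: [Kudla1994] §3 Thm. 3.1; [MoeglinVignerasWaldspurger1987] Chap. 2 II.6, Chap. 3 IV; [KudlaRallis1994] §2; [HarrisKudlaSweet1996] §1.
HONEST LABEL.  Count-neutral helper: `HC_CM` is proved only modulo the 7 printed citations (2 remaining named inputs: hLiu418 = `stmt-HodgeConjecture-24832`,
h413 = `stmt-HodgeConjecture-24833`) until rung 0 closes.
-/

set_option autoImplicit false
set_option linter.dupNamespace false -- the mandated namespace repeats `HodgeConjecture.HodgeConjecture`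
set_option synthInstance.maxHeartbeats 200000 -- rectangular matrix products over the Π-type `L ⊗ L⁺_v = Π_w L_w`: the (failing) coercion search of `binop%` is slow

noncomputable section

open scoped Matrix Kronecker
open NumberField IsDedekindDomain Matrix Topology
open Literature.NumberTheory.Automorphic Literature.NumberTheory.Automorphic.UnitaryGroup
open Literature.NumberTheory.Automorphic.UnitaryGroup.QuadraticCoordinates
open Literature.NumberTheory.GelbartRogawski1991 Literature.NumberTheory.GelbartRogawski1991.GRConstruction
open Literature.NumberTheory.GelbartRogawski1991.UnitaryDualPair
open Literature.NumberTheory.GelbartRogawski1991.UnitaryDualPair.LocalSplitting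
open Literature.NumberTheory.GelbartRogawski1991.AdaptedBlocks
open Literature.NumberTheory.K2Lit.SiegelDoubled
open Literature.RepresentationTheory.HeisenbergGroup
open Summit.HodgeConjecture.HodgeConjecture.Cruxes.HLiu418.K2LiuLocalSWSectionDefs
open Summit.HodgeConjecture.HodgeConjecture.Cruxes.HLiu418.K2LiuDeltaModelRealFrame
open Summit.HodgeConjecture.HodgeConjecture.Cruxes.HLiu418.K2LiuA7ValueInstanceDefs
open Summit.HodgeConjecture.HodgeConjecture.Cruxes.HLiu418.K2LiuNullConeOrbitsNonsplitLocal

namespace Summit.HodgeConjecture.HodgeConjecture.Cruxes.HLiu418.K2LiuA7ValueUnipotentPins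

section CM

variable (L : Type) [Field L] [NumberField L] [IsCMField L]
  {δ : L} (hcδ : IsCMField.complexConj L δ = -δ) (hδ : δ ≠ 0)
variable {N M n : ℕ} (e : Fin N × Fin M ≃ Fin n)
  (dV : Fin N → L) (hdV : ∀ i, IsCMField.complexConj L (dV i) = dV i)
  (dW : Fin M → L) (hdW : ∀ i, IsCMField.complexConj L (dW i) = dW i)
variable {M₂ M' n' : ℕ} (eW : Fin M × Fin M₂ ≃ Fin M') (e' : Fin N × Fin M' ≃ Fin n')
  (dV' : Fin M₂ → L) (hdV' : ∀ k, IsCMField.complexConj L (dV' k) = dV' k)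
variable (v : HeightOneSpectrum (𝓞 (Fp L)))

/-! ## §1 The `n × M₂` matrix of a point and its Gram matrix -/

/-- **`bmat b`** — the point `b : Fin n′ → L ⊗ L⁺_v` of the Δ-model read, through ★ `epsV : Fin n × Fin M₂ ≃ Fin n′`, as an `n × M₂` matrix over `L ⊗ L⁺_v` (`n` vectors of `V′_v`).
[cite: Kudla1994, §3] -/
def bmat (b : Fin n' → LocalRing L v) : Matrix (Fin n) (Fin M₂) (LocalRing L v) :=
  Matrix.of fun i k => b (epsV e eW e' (i, k))

omit [IsCMField L] in
/-- unfolding. [cite: Kudla1994, §3] -/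
theorem bmat_apply (b : Fin n' → LocalRing L v) (i : Fin n) (k : Fin M₂) : bmat L e eW e' v b i k = b (epsV e eW e' (i, k)) :=
  rfl

omit [IsCMField L] in
/-- `bmat` is injective (`epsV` is a bijection). [cite: Kudla1994, §3] -/
theorem bmat_injective : Function.Injective (bmat L e eW e' v (n' := n')) := by
  intro b b' h
  funext a
  obtain ⟨⟨i, k⟩, rfl⟩ := (epsV e eW e').surjective a
  exact congrFun (congrFun h i) k

omit [IsCMField L] in
/-- `bmat` is continuous. [folklore] -/
theorem continuous_bmat : Continuous (bmat L e eW e' v (n' := n')) :=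
  continuous_pi fun _ => continuous_pi fun _ => continuous_apply _

omit [IsCMField L] in
/-- **`bmat (reindex epsV M *ᵥ b) i k = Σ_{i′,k′} M (i,k) (i′,k′) · bmat b i′ k′`**. [cite: Kudla1994, §3] -/
theorem bmat_mulVec_reindex (Mx : Matrix (Fin n × Fin M₂) (Fin n × Fin M₂) (LocalRing L v)) (b : Fin n' → LocalRing L v) (i : Fin n) (k : Fin M₂) :
    bmat L e eW e' v (Matrix.reindex (epsV e eW e') (epsV e eW e') Mx *ᵥ b) i k = ∑ i', ∑ k', Mx (i, k) (i', k') * bmat L e eW e' v b i' k' := by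
  simp only [bmat_apply, Matrix.mulVec, dotProduct, Matrix.reindex_apply, Matrix.submatrix_apply, Equiv.symm_apply_apply]
  rw [← (epsV e eW e').sum_comp, Fintype.sum_prod_type]
  simp only [Equiv.symm_apply_apply]

omit [IsCMField L] in
/-- **the partner action in matrix words**: `bmat (reindex epsV (1 ⊗ₖ G) *ᵥ b) = bmat b · Gᵀ`. [cite: Kudla1994, §3] [cite: MoeglinVignerasWaldspurger1987, Chap. 2 II.6] -/
theorem bmat_mulVec_one_kronecker (G : Matrix (Fin M₂) (Fin M₂) (LocalRing L v)) (b : Fin n' → LocalRing L v) :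
    bmat L e eW e' v (Matrix.reindex (epsV e eW e') (epsV e eW e') ((1 : Matrix (Fin n) (Fin n) (LocalRing L v)) ⊗ₖ G) *ᵥ b) = bmat L e eW e' v b * Gᵀ := by
  refine Matrix.ext fun i k => ?_
  rw [bmat_mulVec_reindex L e eW e' v _ b i k, Matrix.mul_apply,
    Finset.sum_eq_single i (fun i' _ hi' => by simp only [Matrix.kroneckerMap_apply, Matrix.one_apply_ne (Ne.symm hi'), zero_mul, Finset.sum_const_zero])
      (fun h => absurd (Finset.mem_univ i) h)]
  simp only [Matrix.kroneckerMap_apply, Matrix.one_apply_eq, one_mul, Matrix.transpose_apply]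
  exact Finset.sum_congr rfl fun k' _ => mul_comm _ _

omit [IsCMField L] in
/-- **the Levi action in matrix words**: `bmat (reindex epsV (D ⊗ₖ 1) *ᵥ b) = D · bmat b`. [cite: Kudla1994, §3] [cite: MoeglinVignerasWaldspurger1987, Chap. 2 II.6] -/
theorem bmat_mulVec_kronecker_one (D : Matrix (Fin n) (Fin n) (LocalRing L v)) (b : Fin n' → LocalRing L v) :
    bmat L e eW e' v (Matrix.reindex (epsV e eW e') (epsV e eW e') (D ⊗ₖ (1 : Matrix (Fin M₂) (Fin M₂) (LocalRing L v))) *ᵥ b) = D * bmat L e eW e' v b := by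
  refine Matrix.ext fun i k => ?_
  rw [bmat_mulVec_reindex L e eW e' v _ b i k, Matrix.mul_apply]
  refine Finset.sum_congr rfl fun i' _ => ?_
  rw [Finset.sum_eq_single k (fun k' _ hk' => by simp only [Matrix.kroneckerMap_apply, Matrix.one_apply_ne (Ne.symm hk'), mul_zero, zero_mul])
    (fun h => absurd (Finset.mem_univ k) h)]
  simp only [Matrix.kroneckerMap_apply, Matrix.one_apply_eq, mul_one]

/-- **`gramLoc b := (bmat b)^σ · J′_v · (bmat b)ᵀ`** — the `n × n` Gram matrix of the `n` vectors of `V′_v` (`J′_v` = the local Gram matrix of `V′ = (L^{M₂}, diag dV′)`, `σ = conjLocal`).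
The moment map of the dual pair `U(𝔻) × U(V′)`; `{gramLoc = 0}` is the null cone. [cite: Kudla1994, §3 Thm. 3.1] [cite: KudlaRallis1994, §2] -/
def gramLoc (b : Fin n' → LocalRing L v) : Matrix (Fin n) (Fin n) (LocalRing L v) :=
  (bmat L e eW e' v b).map (conjLocal L (IsCMField.complexConj L) v) *
    (adelicForm L M₂ (Matrix.diagonal dV')).map (adeleToLocal L v) * (bmat L e eW e' v b)ᵀ

/-- `gramLoc` is continuous. [folklore] -/
theorem continuous_gramLoc : Continuous (gramLoc L e eW e' dV' v (n' := n')) :=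
  (((continuous_bmat L e eW e' v).matrix_map (continuous_conjLocal L (IsCMField.complexConj L) v)).matrix_mul continuous_const).matrix_mul
    (continuous_bmat L e eW e' v).matrix_transpose

/-- **THE PARTNER GROUP PRESERVES THE GRAM MATRIX**: for `G ∈ U(J′)(L⁺_v)` (`(G^σ)ᵀ J′ G = J′`), `gramLoc (bmat ↦ bmat Gᵀ) = gramLoc`. [cite: Kudla1994, §3 Thm. 3.1]
[cite: MoeglinVignerasWaldspurger1987, Chap. 3 IV] -/
theorem gramLoc_mulVec_one_kronecker {G : Matrix (Fin M₂) (Fin M₂) (LocalRing L v)}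
    (hG : (G.map (conjLocal L (IsCMField.complexConj L) v))ᵀ * (adelicForm L M₂ (Matrix.diagonal dV')).map (adeleToLocal L v) * G =
      (adelicForm L M₂ (Matrix.diagonal dV')).map (adeleToLocal L v))
    (b : Fin n' → LocalRing L v) :
    gramLoc L e eW e' dV' v (Matrix.reindex (epsV e eW e') (epsV e eW e') ((1 : Matrix (Fin n) (Fin n) (LocalRing L v)) ⊗ₖ G) *ᵥ b) = gramLoc L e eW e' dV' v b := by
  rw [gramLoc, gramLoc, bmat_mulVec_one_kronecker, Matrix.map_mul, Matrix.transpose_mul, Matrix.transpose_transpose, Matrix.transpose_map]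
  conv_rhs => rw [← hG]
  simp only [Matrix.mul_assoc]

/-- **THE LEVI MOVES THE GRAM MATRIX BY CONGRUENCE**: `gramLoc (bmat ↦ D bmat) = D^σ · gramLoc · Dᵀ`. [cite: Kudla1994, §3 Thm. 3.1] [cite: KudlaRallis1994, §2] -/
theorem gramLoc_mulVec_kronecker_one (D : Matrix (Fin n) (Fin n) (LocalRing L v)) (b : Fin n' → LocalRing L v) :
    gramLoc L e eW e' dV' v (Matrix.reindex (epsV e eW e') (epsV e eW e') (D ⊗ₖ (1 : Matrix (Fin M₂) (Fin M₂) (LocalRing L v))) *ᵥ b) =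
      D.map (conjLocal L (IsCMField.complexConj L) v) * gramLoc L e eW e' dV' v b * Dᵀ := by
  rw [gramLoc, gramLoc, bmat_mulVec_kronecker_one, Matrix.map_mul, Matrix.transpose_mul]
  simp only [Matrix.mul_assoc]

/-- the COLUMNS currency of ★ `K2LiuNullConeOrbitsNonsplitLocal`: with `X := (bmat b)ᵀ` (an `M₂ × n` matrix), `(X^σ)ᵀ · J′_v · X = gramLoc b`. [cite: Kudla1994, §3] -/
theorem gramLoc_transpose_currency (b : Fin n' → LocalRing L v) :
    ((bmat L e eW e' v b)ᵀ.map (conjLocal L (IsCMField.complexConj L) v))ᵀ * (adelicForm L M₂ (Matrix.diagonal dV')).map (adeleToLocal L v) * (bmat L e eW e' v b)ᵀ =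
      gramLoc L e eW e' dV' v b := by
  rw [gramLoc, Matrix.transpose_map, Matrix.transpose_transpose]

/-! ## §2 The moment map `q = qLoc` on `X_Δ` and the laws `hq`, `hNρ`, `hNa` -/

variable [Algebra.IsQuadraticExtension (Fp L) L]

/-- **THE MOMENT MAP `q : X_Δ → L⁺_v^ι`**, `ι = Fin n × Fin n ⊕ Fin n × Fin n`: the `re` and `im` coordinates (★ `quadraticLocalEquiv`) of the entries of the Gram matrix
`gramLoc (R⁻¹ x)` — the `q` binder of ★ V8e `face_two_of_laws` at the instance ★ I-2. [cite: Kudla1994, §3 Thm. 3.1] [cite: KudlaRallis1994, §2] -/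
def qLoc (x : Fin (n' + n') → v.adicCompletion (Fp L)) : (Fin n × Fin n) ⊕ (Fin n × Fin n) → v.adicCompletion (Fp L) :=
  Sum.elim
    (fun ij => ((quadraticLocalEquiv L v (IsCMField.complexConj L) hcδ hδ).symm
      (gramLoc L e eW e' dV' v ((reFrame (Fp L) L (IsCMField.complexConj L) hcδ hδ v n').symm x) ij.1 ij.2)).1)
    (fun ij => ((quadraticLocalEquiv L v (IsCMField.complexConj L) hcδ hδ).symm
      (gramLoc L e eW e' dV' v ((reFrame (Fp L) L (IsCMField.complexConj L) hcδ hδ v n').symm x) ij.1 ij.2)).2)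

/-- `R⁻¹` is continuous (coordinatewise `Ψ_v (x_L i, x_R i)`, ★ I-0 `reFrame_symm_apply`). [folklore] -/
theorem continuous_reFrame_symm : Continuous fun x : Fin (n' + n') → v.adicCompletion (Fp L) => (reFrame (Fp L) L (IsCMField.complexConj L) hcδ hδ v n').symm x := by
  refine continuous_pi fun i => ?_
  simp only [reFrame_symm_apply]
  exact (quadraticLocalEquiv L v (IsCMField.complexConj L) hcδ hδ).continuous.comp ((continuous_apply _).prodMk (continuous_apply _))

/-- **`hq`: the moment map is continuous.** [folklore] -/
theorem continuous_qLoc : Continuous (qLoc L hcδ hδ e eW e' dV' v (n := n) (n' := n')) := by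
  have hg : Continuous fun x : Fin (n' + n') → v.adicCompletion (Fp L) =>
      gramLoc L e eW e' dV' v ((reFrame (Fp L) L (IsCMField.complexConj L) hcδ hδ v n').symm x) :=
    (continuous_gramLoc L e eW e' dV' v).comp (continuous_reFrame_symm L hcδ hδ v)
  have hij : ∀ ij : Fin n × Fin n, Continuous fun x : Fin (n' + n') → v.adicCompletion (Fp L) =>
      (quadraticLocalEquiv L v (IsCMField.complexConj L) hcδ hδ).symm
        (gramLoc L e eW e' dV' v ((reFrame (Fp L) L (IsCMField.complexConj L) hcδ hδ v n').symm x) ij.1 ij.2) := fun ij =>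
    (quadraticLocalEquiv L v (IsCMField.complexConj L) hcδ hδ).symm.continuous.comp (((continuous_apply ij.2).comp ((continuous_apply ij.1).comp hg)))
  refine continuous_pi fun s => ?_
  rcases s with ij | ij
  · exact continuous_fst.comp (hij ij)
  · exact continuous_snd.comp (hij ij)

/-- **`{q = 0}` IS THE NULL CONE**: `qLoc x = 0 ↔ gramLoc (R⁻¹ x) = 0`. [cite: Kudla1994, §3 Thm. 3.1] -/
theorem qLoc_eq_zero_iff (x : Fin (n' + n') → v.adicCompletion (Fp L)) :
    qLoc L hcδ hδ e eW e' dV' v x = 0 ↔ gramLoc L e eW e' dV' v ((reFrame (Fp L) L (IsCMField.complexConj L) hcδ hδ v n').symm x) = 0 := by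
  set Ψ := quadraticLocalEquiv L v (IsCMField.complexConj L) hcδ hδ with hΨ
  set Q := gramLoc L e eW e' dV' v ((reFrame (Fp L) L (IsCMField.complexConj L) hcδ hδ v n').symm x) with hQ
  constructor
  · intro h
    refine Matrix.ext fun i j => ?_
    have h1 : (Ψ.symm (Q i j)).1 = 0 := congrFun h (Sum.inl (i, j))
    have h2 : (Ψ.symm (Q i j)).2 = 0 := congrFun h (Sum.inr (i, j))
    have h0 : Ψ.symm (Q i j) = 0 := Prod.ext h1 h2
    rw [Matrix.zero_apply, ← Ψ.symm.map_eq_zero_iff]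
    exact h0
  · intro h
    funext s
    rcases s with ⟨i, j⟩ | ⟨i, j⟩
    · show (Ψ.symm (Q i j)).1 = 0
      rw [h, Matrix.zero_apply, map_zero, Prod.fst_zero]
    · show (Ψ.symm (Q i j)).2 = 0
      rw [h, Matrix.zero_apply, map_zero, Prod.snd_zero]

/-- the Gram matrix is unchanged by the partner action `ρ g` (★ I-2 `rhoLoc`). [cite: Kudla1994, §3 Thm. 3.1] [cite: MoeglinVignerasWaldspurger1987, Chap. 3 IV] -/
theorem gramLoc_reFrame_symm_rhoLoc (g : UnitaryGroup.localPi L (IsCMField.complexConj L) M₂ (Matrix.diagonal dV') v) (x : Fin (n' + n') → v.adicCompletion (Fp L)) :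
    gramLoc L e eW e' dV' v ((reFrame (Fp L) L (IsCMField.complexConj L) hcδ hδ v n').symm (rhoLoc L hcδ hδ e dV hdV dW hdW eW e' dV' hdV' v g x)) =
      gramLoc L e eW e' dV' v ((reFrame (Fp L) L (IsCMField.complexConj L) hcδ hδ v n').symm x) := by
  rw [rhoLoc_apply, leviAct_apply, LinearEquiv.symm_apply_apply, val_partnerBlkDHom]
  refine gramLoc_mulVec_one_kronecker L e eW e' dV' v ?_ _
  -- `G = (localPiEquiv g).1 ∈ U(J′)(L⁺_v)`
  have hmem := (UnitaryGroup.localPiEquiv L (IsCMField.complexConj L) M₂ (Matrix.diagonal dV') v g).2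
  rw [UnitaryGroup.coe_localPiEquiv_apply] at hmem
  exact hmem

/-- **`hNρ` (EXACT): the moment map is invariant under the partner group**, `qLoc (ρ g x) = qLoc x`. [cite: Kudla1994, §3 Thm. 3.1] [cite: MoeglinVignerasWaldspurger1987, Chap. 3 IV] -/
theorem qLoc_rhoLoc (g : UnitaryGroup.localPi L (IsCMField.complexConj L) M₂ (Matrix.diagonal dV') v) (x : Fin (n' + n') → v.adicCompletion (Fp L)) :
    qLoc L hcδ hδ e eW e' dV' v (rhoLoc L hcδ hδ e dV hdV dW hdW eW e' dV' hdV' v g x) = qLoc L hcδ hδ e eW e' dV' v x := by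
  unfold qLoc
  rw [gramLoc_reFrame_symm_rhoLoc]

/-- the binder shape of ★ V8e: `q x = 0 → q (ρ g x) = 0`. [cite: Kudla1994, §3 Thm. 3.1] -/
theorem qLoc_rhoLoc_eq_zero (g : UnitaryGroup.localPi L (IsCMField.complexConj L) M₂ (Matrix.diagonal dV') v) (x : Fin (n' + n') → v.adicCompletion (Fp L))
    (hx : qLoc L hcδ hδ e eW e' dV' v x = 0) : qLoc L hcδ hδ e eW e' dV' v (rhoLoc L hcδ hδ e dV hdV dW hdW eW e' dV' hdV' v g x) = 0 := by
  rw [qLoc_rhoLoc, hx]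

/-- the Gram matrix moves by congruence under the Levi action `aX m` (★ I-2 `leviRhoLoc`). [cite: Kudla1994, §3 Thm. 3.1] [cite: KudlaRallis1994, §2] -/
theorem gramLoc_reFrame_symm_leviRhoLoc (m : ↥(leviDeltaLoc L e dV hdV dW hdW v)) (x : Fin (n' + n') → v.adicCompletion (Fp L)) :
    gramLoc L e eW e' dV' v ((reFrame (Fp L) L (IsCMField.complexConj L) hcδ hδ v n').symm (leviRhoLoc L hcδ hδ e dV hdV dW hdW eW e' dV' hdV' v m x)) =
      (blkD (matA (Fp L) L (IsCMField.complexConj L) v n (m : UnitaryGroup.localPi L (IsCMField.complexConj L) (n + n) (hermD L e dV hdV dW hdW) v))).map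
          (conjLocal L (IsCMField.complexConj L) v) *
        gramLoc L e eW e' dV' v ((reFrame (Fp L) L (IsCMField.complexConj L) hcδ hδ v n').symm x) *
        (blkD (matA (Fp L) L (IsCMField.complexConj L) v n (m : UnitaryGroup.localPi L (IsCMField.complexConj L) (n + n) (hermD L e dV hdV dW hdW) v)))ᵀ := by
  rw [leviRhoLoc_apply, leviBlkDHom_apply, leviAct_apply, LinearEquiv.symm_apply_apply, val_leviBlkD]
  exact gramLoc_mulVec_kronecker_one L e eW e' dV' v _ _

/-- **`hNa`: the null cone is stable under the Levi action**, `q x = 0 → q (aX m x) = 0`. [cite: Kudla1994, §3 Thm. 3.1] [cite: KudlaRallis1994, §2] -/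
theorem qLoc_leviRhoLoc_eq_zero (m : ↥(leviDeltaLoc L e dV hdV dW hdW v)) (x : Fin (n' + n') → v.adicCompletion (Fp L))
    (hx : qLoc L hcδ hδ e eW e' dV' v x = 0) : qLoc L hcδ hδ e eW e' dV' v (leviRhoLoc L hcδ hδ e dV hdV dW hdW eW e' dV' hdV' v m x) = 0 := by
  rw [qLoc_eq_zero_iff] at hx ⊢
  rw [gramLoc_reFrame_symm_leviRhoLoc, hx, Matrix.mul_zero, Matrix.zero_mul]

end CM

/-! ## §3 `htrans` at `n = 2`, `M₂ = 3`, at a non-split place -/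

section Trans

variable (L : Type) [Field L] [NumberField L] [IsCMField L] [Algebra.IsQuadraticExtension (Fp L) L]
  {δ : L} (hcδ : IsCMField.complexConj L δ = -δ) (hδ : δ ≠ 0)
variable {N M : ℕ} (e : Fin N × Fin M ≃ Fin 2)
  (dV : Fin N → L) (hdV : ∀ i, IsCMField.complexConj L (dV i) = dV i)
  (dW : Fin M → L) (hdW : ∀ i, IsCMField.complexConj L (dW i) = dW i)
variable {M' n' : ℕ} (eW : Fin M × Fin 3 ≃ Fin M') (e' : Fin N × Fin M' ≃ Fin n')
  (dV' : Fin 3 → L) (hdV' : ∀ k, IsCMField.complexConj L (dV' k) = dV' k)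
variable (v : HeightOneSpectrum (𝓞 (Fp L)))

omit [Algebra.IsQuadraticExtension (Fp L) L] in
include hdV' in
/-- the Gram matrix `diag dV′` of `V′` is hermitian (real diagonal). [cite: Kudla1994, §3] -/
theorem diagonal_dV'_hermitian : ((Matrix.diagonal dV').map (IsCMField.complexConj L))ᵀ = Matrix.diagonal dV' := by
  rw [Matrix.diagonal_map (map_zero _), Matrix.diagonal_transpose]
  exact congrArg Matrix.diagonal (funext hdV')

set_option maxHeartbeats 800000 in -- measured: the `M_Δ`-subgroup coercions over `L ⊗ L⁺_v` unfold slowly (as ★ I-2 `leviBlkDHom`)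
include hdV' in
/-- **`htrans` — THE LEVI AND THE PARTNER ACT TRANSITIVELY ON THE NON-ZERO NULL CONE (non-split `v`)**: for `x, y ∈ X_Δ` with `q x = q y = 0`, `x, y ≠ 0`, there are
`m ∈ M_Δ` and `g ∈ U(V′)(L⁺_v)` with `aX m (ρ g x) = y`.  From ★ `exists_local_mul_mul_eq_of_null` ((O1) in the local currency: `g · (bmat x)ᵀ · a = (bmat y)ᵀ`, `det a` a unit) and the
surjectivity `hsurj` of `m ↦ D(m)` onto `GL₂(L ⊗ L⁺_v)` (BY VALUE). [cite: Kudla1994, §3 Thm. 3.1] [cite: MoeglinVignerasWaldspurger1987, Chap. 3 IV] -/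
theorem exists_leviRhoLoc_rhoLoc_eq (hc : IsCMField.complexConj L ≠ 1) (w : UnitaryGroup.PlacesOver L v) (hw : IsCMField.complexConj L • w.1 = w.1)
    (hdV'0 : ∀ k, dV' k ≠ 0)
    (hsurj : ∀ D : GL (Fin 2) (LocalRing L v), ∃ m : ↥(leviDeltaLoc L e dV hdV dW hdW v),
      blkD (matA (Fp L) L (IsCMField.complexConj L) v 2 (m : UnitaryGroup.localPi L (IsCMField.complexConj L) (2 + 2) (hermD L e dV hdV dW hdW) v)) = D.val)
    (x y : Fin (n' + n') → v.adicCompletion (Fp L)) (hx : qLoc L hcδ hδ e eW e' dV' v x = 0) (hy : qLoc L hcδ hδ e eW e' dV' v y = 0) (hx0 : x ≠ 0) (hy0 : y ≠ 0) :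
    ∃ (m : ↥(leviDeltaLoc L e dV hdV dW hdW v)) (g : UnitaryGroup.localPi L (IsCMField.complexConj L) 3 (Matrix.diagonal dV') v),
      leviRhoLoc L hcδ hδ e dV hdV dW hdW eW e' dV' hdV' v m (rhoLoc L hcδ hδ e dV hdV dW hdW eW e' dV' hdV' v g x) = y := by
  set R := reFrame (Fp L) L (IsCMField.complexConj L) hcδ hδ v n' with hR
  set bx := R.symm x with hbx
  set by_ := R.symm y with hby
  -- the two points as `3 × 2` matrices (columns), null and non-zero
  have hnull : ∀ {z : Fin (n' + n') → v.adicCompletion (Fp L)}, qLoc L hcδ hδ e eW e' dV' v z = 0 →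
      (((bmat L e eW e' v (R.symm z))ᵀ).map (conjLocal L (IsCMField.complexConj L) v))ᵀ * (adelicForm L 3 (Matrix.diagonal dV')).map (adeleToLocal L v) *
        (bmat L e eW e' v (R.symm z))ᵀ = 0 := fun hz => by
    rw [gramLoc_transpose_currency]
    exact (qLoc_eq_zero_iff L hcδ hδ e eW e' dV' v _).1 hz
  have hne : ∀ {z : Fin (n' + n') → v.adicCompletion (Fp L)}, z ≠ 0 → (bmat L e eW e' v (R.symm z))ᵀ ≠ 0 := fun {z} hz h => hz (by
    have h1 : bmat L e eW e' v (R.symm z) = bmat L e eW e' v (R.symm 0) := by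
      rw [map_zero, ← Matrix.transpose_transpose (bmat L e eW e' v (R.symm z)), h, Matrix.transpose_zero]
      exact (Matrix.ext fun i k => by rw [bmat_apply, Pi.zero_apply, Matrix.zero_apply]).symm
    exact R.symm.injective (bmat_injective L e eW e' v h1))
  obtain ⟨g, a, ha, hga⟩ := exists_local_mul_mul_eq_of_null (IsCMField.complexConj L) hc w hw (Matrix.diagonal dV') (diagonal_dV'_hermitian L dV' hdV')
    (by rw [Matrix.det_diagonal]; exact Finset.prod_ne_zero_iff.2 fun k _ => hdV'0 k) _ _ (hnull hx) (hne hx0) (hnull hy) (hne hy0)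
  -- transpose: `bmat y = aᵀ · bmat x · gᵀ`
  have hT : bmat L e eW e' v by_ = aᵀ * bmat L e eW e' v bx * (Units.val (g : GL (Fin 3) (LocalRing L v)))ᵀ := by
    have h := congrArg Matrix.transpose hga
    rw [Matrix.transpose_transpose, Matrix.transpose_mul, Matrix.transpose_mul, Matrix.transpose_transpose] at h
    rw [← h, Matrix.mul_assoc]
  -- the Levi element with `D(m) = aᵀ`
  have haT : IsUnit (aᵀ : Matrix (Fin 2) (Fin 2) (LocalRing L v)) := by
    rw [Matrix.isUnit_iff_isUnit_det, Matrix.det_transpose]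
    exact ha
  obtain ⟨m, hm⟩ := hsurj haT.unit
  -- the partner element with matrix `g`
  set g' := (UnitaryGroup.localPiEquiv L (IsCMField.complexConj L) 3 (Matrix.diagonal dV') v).symm g with hg'
  have hG : ((UnitaryGroup.localGLPiEquiv L 3 v).symm (g' : UnitaryGroup.LocalGLPi L 3 v)).val = Units.val (g : GL (Fin 3) (LocalRing L v)) := by
    rw [← UnitaryGroup.coe_localPiEquiv_apply, hg', (UnitaryGroup.localPiEquiv L (IsCMField.complexConj L) 3 (Matrix.diagonal dV') v).apply_symm_apply]
  refine ⟨m, g', ?_⟩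
  -- compute both sides on the real frame
  have hxR : x = R bx := (R.apply_symm_apply x).symm
  rw [hxR, rhoLoc_apply, leviAct_apply_reFrame, val_partnerBlkDHom, hG, leviRhoLoc_apply, leviBlkDHom_apply, leviAct_apply_reFrame, val_leviBlkD, hm,
    IsUnit.unit_spec, ← R.apply_symm_apply y]
  congr 1
  apply bmat_injective L e eW e' v
  rw [bmat_mulVec_kronecker_one, bmat_mulVec_one_kronecker, ← hby, hT, Matrix.mul_assoc]

end Trans

end Summit.HodgeConjecture.HodgeConjecture.Cruxes.HLiu418.K2LiuA7ValueUnipotentPins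

end
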